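import Summits.CriticalPhenomena.PercolationContinuityZ3.Theorems.SahiAEPlanePrelim

/-!
# The planar structure theorem, gluing step: rectangle increments of four quadrant versions glued along a cross

Support file of the Sahi cell (`prim-sahi`, typer seat, generation 22; `--supports stmt-CriticalPhenomena-4575`).
Theorems only (no definitions, no named facts, no sorries); elementary real inequalities, no measure theory.

Given a base point `b = (s₀, t₀)` and, for each of the four open quadrants around `b`, a function which is
supermodular, suitably monotone and sign-definite there (the quadrant versions of `SahiAEPlaneQuadrant.lean`, the
three non-principal quadrants being reached through the reflections `(x₀, −x₁)`, `(−x₀, x₁)`, `−x` applied to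
`−φ`, `−φ`, `φ`), the glued function

  `D̃(x) = E_b G₀(x) − E_{b₁} G₁(x₀, −x₁) − E_{b₂} G₂(−x₀, x₁) + E_{b₃} G₃(−x₀, −x₁)`,

`E_c G = 𝟙_{Q(c)} · G` the extension by `0` off the open quadrant `Q(c) = {u₀ > c₀, u₁ > c₁}`, vanishes on the cross
through `b` and has NON-NEGATIVE INCREMENTS ON EVERY RECTANGLE of the plane:

* `Plane.rect_nonneg_indicator` — one closed quadrant: `E_c G(s,t') + E_c G(s',t) ≤ E_c G(s,t) + E_c G(s',t')` for
  `c₀ ≤ s ≤ s'`, `c₁ ≤ t ≤ t'` (interior rectangles: supermodularity; rectangles with an edge on the cross: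
  monotonicity; the corner rectangle: sign);
* `Plane.rect_nonneg_glue` — all rectangles, by additivity of rectangle increments under subdivision at `s₀`, `t₀`.

No sorries, no new axioms.
-/

noncomputable section

namespace Summit.CriticalPhenomena.PercolationContinuityZ3.Theorems.SahiAEFourFunctions.Plane

open Set

/-- First coordinate of an explicit point. [folklore] -/
@[simp] private theorem vec_zero'' (s t : ℝ) : (![s, t] : Fin 2 → ℝ) 0 = s := rfl

/-- Second coordinate of an explicit point. [folklore] -/
@[simp] private theorem vec_one'' (s t : ℝ) : (![s, t] : Fin 2 → ℝ) 1 = t := rfl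

/-! ### One closed quadrant -/

section OneQuadrant

variable {c : Fin 2 → ℝ} {G : (Fin 2 → ℝ) → ℝ}

/-- The extension by zero is non-negative. [folklore] -/
theorem indicator_quadrant_nonneg (hnn : ∀ x : Fin 2 → ℝ, c 0 < x 0 → c 1 < x 1 → 0 ≤ G x) (u : Fin 2 → ℝ) :
    0 ≤ ({x : Fin 2 → ℝ | c 0 < x 0 ∧ c 1 < x 1} : Set (Fin 2 → ℝ)).indicator G u := by
  by_cases hu : u ∈ ({x : Fin 2 → ℝ | c 0 < x 0 ∧ c 1 < x 1} : Set (Fin 2 → ℝ))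
  · rw [Set.indicator_of_mem hu]; exact hnn u hu.1 hu.2
  · rw [Set.indicator_of_notMem hu]

/-- **Rectangle increments of the extension by zero over one closed quadrant.**  If `G` is supermodular at every pair
of the open quadrant `Q(c)`, non-decreasing at every comparable pair of `Q(c)` and non-negative on `Q(c)`, then
`𝟙_{Q(c)} G` has non-negative increments on every rectangle of the CLOSED quadrant. [this work] -/
theorem rect_nonneg_indicator
    (hsm : ∀ x y : Fin 2 → ℝ, c 0 < x 0 → c 1 < x 1 → c 0 < y 0 → c 1 < y 1 → G x + G y ≤ G (x ⊓ y) + G (x ⊔ y))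
    (hmono : ∀ x y : Fin 2 → ℝ, c 0 < x 0 → c 1 < x 1 → x ≤ y → G x ≤ G y)
    (hnn : ∀ x : Fin 2 → ℝ, c 0 < x 0 → c 1 < x 1 → 0 ≤ G x)
    {s s' t t' : ℝ} (hs : c 0 ≤ s) (hss' : s ≤ s') (ht : c 1 ≤ t) (htt' : t ≤ t') :
    ({x : Fin 2 → ℝ | c 0 < x 0 ∧ c 1 < x 1} : Set (Fin 2 → ℝ)).indicator G ![s, t'] +
        ({x : Fin 2 → ℝ | c 0 < x 0 ∧ c 1 < x 1} : Set (Fin 2 → ℝ)).indicator G ![s', t] ≤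
      ({x : Fin 2 → ℝ | c 0 < x 0 ∧ c 1 < x 1} : Set (Fin 2 → ℝ)).indicator G ![s, t] +
        ({x : Fin 2 → ℝ | c 0 < x 0 ∧ c 1 < x 1} : Set (Fin 2 → ℝ)).indicator G ![s', t'] := by
  set Q : Set (Fin 2 → ℝ) := {x : Fin 2 → ℝ | c 0 < x 0 ∧ c 1 < x 1} with hQ
  have hE0 : ∀ u : Fin 2 → ℝ, ¬ (c 0 < u 0 ∧ c 1 < u 1) → Q.indicator G u = 0 := fun u hu =>
    Set.indicator_of_notMem (show u ∉ Q from hu) _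
  have hE1 : ∀ u : Fin 2 → ℝ, c 0 < u 0 → c 1 < u 1 → Q.indicator G u = G u := fun u h0 h1 =>
    Set.indicator_of_mem (show u ∈ Q from ⟨h0, h1⟩) _
  have hEnn : ∀ u, 0 ≤ Q.indicator G u := indicator_quadrant_nonneg hnn
  have hEmono : ∀ u v : Fin 2 → ℝ, c 0 < u 0 → c 1 < u 1 → u ≤ v → Q.indicator G u ≤ Q.indicator G v := by
    intro u v h0 h1 huv
    rw [hE1 u h0 h1, hE1 v (h0.trans_le (huv 0)) (h1.trans_le (huv 1))]
    exact hmono u v h0 h1 huv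
  rcases hs.eq_or_lt with hs0 | hs0
  · -- left edge on the cross: `s = c 0`
    rw [hE0 ![s, t'] (by simp [← hs0]), hE0 ![s, t] (by simp [← hs0]), zero_add, zero_add]
    rcases (hs.trans hss').eq_or_lt with hs1 | hs1
    · rw [hE0 ![s', t] (by simp [← hs1]), hE0 ![s', t'] (by simp [← hs1])]
    rcases ht.eq_or_lt with ht0 | ht0
    · rw [hE0 ![s', t] (by simp [← ht0])]; exact hEnn _
    · exact hEmono _ _ (by simpa using hs1) (by simpa using ht0) (vec_le_vec.2 ⟨le_rfl, htt'⟩)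
  · rcases ht.eq_or_lt with ht0 | ht0
    · -- bottom edge on the cross: `t = c 1`
      rw [hE0 ![s', t] (by simp [← ht0]), hE0 ![s, t] (by simp [← ht0]), add_zero, zero_add]
      rcases (ht.trans htt').eq_or_lt with ht1 | ht1
      · rw [hE0 ![s, t'] (by simp [← ht1]), hE0 ![s', t'] (by simp [← ht1])]
      · exact hEmono _ _ (by simpa using hs0) (by simpa using ht1) (vec_le_vec.2 ⟨hss', le_rfl⟩)
    · -- interior rectangle
      have hs1 : c 0 < s' := hs0.trans_le hss'
      have ht1 : c 1 < t' := ht0.trans_le htt'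
      rw [hE1 ![s, t'] (by simpa using hs0) (by simpa using ht1), hE1 ![s', t] (by simpa using hs1) (by simpa using ht0),
        hE1 ![s, t] (by simpa using hs0) (by simpa using ht0), hE1 ![s', t'] (by simpa using hs1) (by simpa using ht1)]
      have h := hsm ![s, t'] ![s', t] (by simpa using hs0) (by simpa using ht1) (by simpa using hs1) (by simpa using ht0)
      rwa [vec_inf_vec, vec_sup_vec, min_eq_left hss', max_eq_left htt', max_eq_right hss', min_eq_right htt'] at h

end OneQuadrant

/-! ### Four quadrants glued along the cross -/

/-- **Non-negative increments on every rectangle for the glued function.**  See the module docstring: the glued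
function is `E_b G₀(x) − E_{b₁} G₁(x₀, −x₁) − E_{b₂} G₂(−x₀, x₁) + E_{b₃} G₃(−x₀, −x₁)` with `b₁ = (b₀, −b₁)`,
`b₂ = (−b₀, b₁)`, `b₃ = −b`, each `Gⱼ` supermodular / non-decreasing / non-negative on its open quadrant. [this work] -/
theorem rect_nonneg_glue (b : Fin 2 → ℝ) (G₀ G₁ G₂ G₃ : (Fin 2 → ℝ) → ℝ)
    (h₀s : ∀ x y : Fin 2 → ℝ, b 0 < x 0 → b 1 < x 1 → b 0 < y 0 → b 1 < y 1 → G₀ x + G₀ y ≤ G₀ (x ⊓ y) + G₀ (x ⊔ y))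
    (h₀m : ∀ x y : Fin 2 → ℝ, b 0 < x 0 → b 1 < x 1 → x ≤ y → G₀ x ≤ G₀ y)
    (h₀n : ∀ x : Fin 2 → ℝ, b 0 < x 0 → b 1 < x 1 → 0 ≤ G₀ x)
    (h₁s : ∀ x y : Fin 2 → ℝ, b 0 < x 0 → -b 1 < x 1 → b 0 < y 0 → -b 1 < y 1 → G₁ x + G₁ y ≤ G₁ (x ⊓ y) + G₁ (x ⊔ y))
    (h₁m : ∀ x y : Fin 2 → ℝ, b 0 < x 0 → -b 1 < x 1 → x ≤ y → G₁ x ≤ G₁ y)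
    (h₁n : ∀ x : Fin 2 → ℝ, b 0 < x 0 → -b 1 < x 1 → 0 ≤ G₁ x)
    (h₂s : ∀ x y : Fin 2 → ℝ, -b 0 < x 0 → b 1 < x 1 → -b 0 < y 0 → b 1 < y 1 → G₂ x + G₂ y ≤ G₂ (x ⊓ y) + G₂ (x ⊔ y))
    (h₂m : ∀ x y : Fin 2 → ℝ, -b 0 < x 0 → b 1 < x 1 → x ≤ y → G₂ x ≤ G₂ y)
    (h₂n : ∀ x : Fin 2 → ℝ, -b 0 < x 0 → b 1 < x 1 → 0 ≤ G₂ x)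
    (h₃s : ∀ x y : Fin 2 → ℝ, -b 0 < x 0 → -b 1 < x 1 → -b 0 < y 0 → -b 1 < y 1 → G₃ x + G₃ y ≤ G₃ (x ⊓ y) + G₃ (x ⊔ y))
    (h₃m : ∀ x y : Fin 2 → ℝ, -b 0 < x 0 → -b 1 < x 1 → x ≤ y → G₃ x ≤ G₃ y)
    (h₃n : ∀ x : Fin 2 → ℝ, -b 0 < x 0 → -b 1 < x 1 → 0 ≤ G₃ x)
    (Dt : (Fin 2 → ℝ) → ℝ)
    (hDt : ∀ x, Dt x =
      ({u : Fin 2 → ℝ | b 0 < u 0 ∧ b 1 < u 1} : Set (Fin 2 → ℝ)).indicator G₀ x -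
        ({u : Fin 2 → ℝ | (![b 0, -b 1] : Fin 2 → ℝ) 0 < u 0 ∧ (![b 0, -b 1] : Fin 2 → ℝ) 1 < u 1} :
            Set (Fin 2 → ℝ)).indicator G₁ ![x 0, -x 1] -
        ({u : Fin 2 → ℝ | (![-b 0, b 1] : Fin 2 → ℝ) 0 < u 0 ∧ (![-b 0, b 1] : Fin 2 → ℝ) 1 < u 1} :
            Set (Fin 2 → ℝ)).indicator G₂ ![-x 0, x 1] +
        ({u : Fin 2 → ℝ | (![-b 0, -b 1] : Fin 2 → ℝ) 0 < u 0 ∧ (![-b 0, -b 1] : Fin 2 → ℝ) 1 < u 1} :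
            Set (Fin 2 → ℝ)).indicator G₃ ![-x 0, -x 1])
    {s s' t t' : ℝ} (hss' : s ≤ s') (htt' : t ≤ t') :
    Dt ![s, t'] + Dt ![s', t] ≤ Dt ![s, t] + Dt ![s', t'] := by
  -- the four extensions by zero
  set E₀ : (Fin 2 → ℝ) → ℝ := ({u : Fin 2 → ℝ | b 0 < u 0 ∧ b 1 < u 1} : Set (Fin 2 → ℝ)).indicator G₀ with hE₀
  set E₁ : (Fin 2 → ℝ) → ℝ := ({u : Fin 2 → ℝ | (![b 0, -b 1] : Fin 2 → ℝ) 0 < u 0 ∧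
    (![b 0, -b 1] : Fin 2 → ℝ) 1 < u 1} : Set (Fin 2 → ℝ)).indicator G₁ with hE₁
  set E₂ : (Fin 2 → ℝ) → ℝ := ({u : Fin 2 → ℝ | (![-b 0, b 1] : Fin 2 → ℝ) 0 < u 0 ∧
    (![-b 0, b 1] : Fin 2 → ℝ) 1 < u 1} : Set (Fin 2 → ℝ)).indicator G₂ with hE₂
  set E₃ : (Fin 2 → ℝ) → ℝ := ({u : Fin 2 → ℝ | (![-b 0, -b 1] : Fin 2 → ℝ) 0 < u 0 ∧
    (![-b 0, -b 1] : Fin 2 → ℝ) 1 < u 1} : Set (Fin 2 → ℝ)).indicator G₃ with hE₃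
  -- vanishing off the respective open quadrants
  have z₀ : ∀ a d : ℝ, a ≤ b 0 ∨ d ≤ b 1 → E₀ ![a, d] = 0 := fun a d h =>
    Set.indicator_of_notMem (by
      simp only [Set.mem_setOf_eq, vec_zero'', vec_one'', not_and, not_lt]
      intro h1; rcases h with h | h
      · exact absurd h1 (not_lt.2 h)
      · exact h) _
  have z₁ : ∀ a d : ℝ, a ≤ b 0 ∨ b 1 ≤ d → E₁ ![a, -d] = 0 := fun a d h =>
    Set.indicator_of_notMem (by
      simp only [Set.mem_setOf_eq, vec_zero'', vec_one'', not_and, not_lt, neg_le_neg_iff]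
      intro h1; rcases h with h | h
      · exact absurd h1 (not_lt.2 h)
      · exact h) _
  have z₂ : ∀ a d : ℝ, b 0 ≤ a ∨ d ≤ b 1 → E₂ ![-a, d] = 0 := fun a d h =>
    Set.indicator_of_notMem (by
      simp only [Set.mem_setOf_eq, vec_zero'', vec_one'', not_and, not_lt]
      intro h1; rcases h with h | h
      · exact absurd h1 (not_lt.2 (neg_le_neg h))
      · exact h) _
  have z₃ : ∀ a d : ℝ, b 0 ≤ a ∨ b 1 ≤ d → E₃ ![-a, -d] = 0 := fun a d h =>
    Set.indicator_of_notMem (by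
      simp only [Set.mem_setOf_eq, vec_zero'', vec_one'', not_and, not_lt, neg_le_neg_iff]
      intro h1; rcases h with h | h
      · exact absurd h1 (not_lt.2 (neg_le_neg h))
      · exact h) _
  -- the four closed-quadrant rectangle inequalities
  have r₀ : ∀ {a a' d d' : ℝ}, b 0 ≤ a → a ≤ a' → b 1 ≤ d → d ≤ d' →
      E₀ ![a, d'] + E₀ ![a', d] ≤ E₀ ![a, d] + E₀ ![a', d'] := fun ha haa' hd hdd' =>
    rect_nonneg_indicator h₀s h₀m h₀n ha haa' hd hdd'
  have r₁ : ∀ {a a' d d' : ℝ}, b 0 ≤ a → a ≤ a' → -b 1 ≤ d → d ≤ d' →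
      E₁ ![a, d'] + E₁ ![a', d] ≤ E₁ ![a, d] + E₁ ![a', d'] := fun ha haa' hd hdd' =>
    rect_nonneg_indicator (c := ![b 0, -b 1]) (by simpa using h₁s) (by simpa using h₁m) (by simpa using h₁n)
      (by simpa using ha) haa' (by simpa using hd) hdd'
  have r₂ : ∀ {a a' d d' : ℝ}, -b 0 ≤ a → a ≤ a' → b 1 ≤ d → d ≤ d' →
      E₂ ![a, d'] + E₂ ![a', d] ≤ E₂ ![a, d] + E₂ ![a', d'] := fun ha haa' hd hdd' =>
    rect_nonneg_indicator (c := ![-b 0, b 1]) (by simpa using h₂s) (by simpa using h₂m) (by simpa using h₂n)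
      (by simpa using ha) haa' (by simpa using hd) hdd'
  have r₃ : ∀ {a a' d d' : ℝ}, -b 0 ≤ a → a ≤ a' → -b 1 ≤ d → d ≤ d' →
      E₃ ![a, d'] + E₃ ![a', d] ≤ E₃ ![a, d] + E₃ ![a', d'] := fun ha haa' hd hdd' =>
    rect_nonneg_indicator (c := ![-b 0, -b 1]) (by simpa using h₃s) (by simpa using h₃m) (by simpa using h₃n)
      (by simpa using ha) haa' (by simpa using hd) hdd'
  -- `Dt` at explicit points
  have hDt' : ∀ a d : ℝ, Dt ![a, d] = E₀ ![a, d] - E₁ ![a, -d] - E₂ ![-a, d] + E₃ ![-a, -d] := fun a d => by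
    rw [hDt]; simp only [vec_zero'', vec_one'']
  -- rectangles inside one closed quadrant
  have quad : ∀ a a' d d' : ℝ, a ≤ a' → d ≤ d' → (b 0 ≤ a ∨ a' ≤ b 0) → (b 1 ≤ d ∨ d' ≤ b 1) →
      Dt ![a, d'] + Dt ![a', d] ≤ Dt ![a, d] + Dt ![a', d'] := by
    intro a a' d d' haa' hdd' hA hD
    rw [hDt' a d', hDt' a' d, hDt' a d, hDt' a' d']
    rcases hA with hA | hA <;> rcases hD with hD | hD
    · -- closed `Q₀`
      have hA' : b 0 ≤ a' := hA.trans haa'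
      have hD' : b 1 ≤ d' := hD.trans hdd'
      rw [z₁ a d' (Or.inr hD'), z₁ a' d (Or.inr hD), z₁ a d (Or.inr hD), z₁ a' d' (Or.inr hD'),
        z₂ a d' (Or.inl hA), z₂ a' d (Or.inl hA'), z₂ a d (Or.inl hA), z₂ a' d' (Or.inl hA'),
        z₃ a d' (Or.inl hA), z₃ a' d (Or.inl hA'), z₃ a d (Or.inl hA), z₃ a' d' (Or.inl hA')]
      have := r₀ hA haa' hD hdd'
      linarith
    · -- closed `Q₊₋`: `a ≥ b 0`, `d' ≤ b 1`
      have hA' : b 0 ≤ a' := hA.trans haa'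
      have hD' : d ≤ b 1 := hdd'.trans hD
      rw [z₀ a d' (Or.inr hD), z₀ a' d (Or.inr hD'), z₀ a d (Or.inr hD'), z₀ a' d' (Or.inr hD),
        z₂ a d' (Or.inl hA), z₂ a' d (Or.inl hA'), z₂ a d (Or.inl hA), z₂ a' d' (Or.inl hA'),
        z₃ a d' (Or.inl hA), z₃ a' d (Or.inl hA'), z₃ a d (Or.inl hA), z₃ a' d' (Or.inl hA')]
      have := r₁ hA haa' (neg_le_neg hD) (neg_le_neg hdd')
      linarith
    · -- closed `Q₋₊`: `a' ≤ b 0`, `d ≥ b 1`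
      have hA' : a ≤ b 0 := haa'.trans hA
      have hD' : b 1 ≤ d' := hD.trans hdd'
      rw [z₀ a d' (Or.inl hA'), z₀ a' d (Or.inl hA), z₀ a d (Or.inl hA'), z₀ a' d' (Or.inl hA),
        z₁ a d' (Or.inl hA'), z₁ a' d (Or.inl hA), z₁ a d (Or.inl hA'), z₁ a' d' (Or.inl hA),
        z₃ a d' (Or.inr hD'), z₃ a' d (Or.inr hD), z₃ a d (Or.inr hD), z₃ a' d' (Or.inr hD')]
      have := r₂ (neg_le_neg hA) (neg_le_neg haa') hD hdd'
      linarith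
    · -- closed `Q₋₋`: `a' ≤ b 0`, `d' ≤ b 1`
      have hA' : a ≤ b 0 := haa'.trans hA
      have hD' : d ≤ b 1 := hdd'.trans hD
      rw [z₀ a d' (Or.inl hA'), z₀ a' d (Or.inl hA), z₀ a d (Or.inl hA'), z₀ a' d' (Or.inl hA),
        z₁ a d' (Or.inl hA'), z₁ a' d (Or.inl hA), z₁ a d (Or.inl hA'), z₁ a' d' (Or.inl hA),
        z₂ a d' (Or.inr hD), z₂ a' d (Or.inr hD'), z₂ a d (Or.inr hD'), z₂ a' d' (Or.inr hD)]
      have := r₃ (neg_le_neg hA) (neg_le_neg haa') (neg_le_neg hD) (neg_le_neg hdd')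
      linarith
  -- rectangles inside a closed half-plane `{b 1 ≤ d}` or `{d' ≤ b 1}`: subdivide at `b 0`
  have half : ∀ a a' d d' : ℝ, a ≤ a' → d ≤ d' → (b 1 ≤ d ∨ d' ≤ b 1) →
      Dt ![a, d'] + Dt ![a', d] ≤ Dt ![a, d] + Dt ![a', d'] := by
    intro a a' d d' haa' hdd' hD
    by_cases hA : b 0 ≤ a
    · exact quad a a' d d' haa' hdd' (Or.inl hA) hD
    by_cases hA' : a' ≤ b 0
    · exact quad a a' d d' haa' hdd' (Or.inr hA') hD
    push Not at hA hA'
    have h1 := quad a (b 0) d d' hA.le hdd' (Or.inr le_rfl) hD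
    have h2 := quad (b 0) a' d d' hA'.le hdd' (Or.inl le_rfl) hD
    linarith
  -- all rectangles: subdivide at `b 1`
  by_cases hD : b 1 ≤ t
  · exact half s s' t t' hss' htt' (Or.inl hD)
  by_cases hD' : t' ≤ b 1
  · exact half s s' t t' hss' htt' (Or.inr hD')
  push Not at hD hD'
  have h1 := half s s' t (b 1) hss' hD.le (Or.inr le_rfl)
  have h2 := half s s' (b 1) t' hss' hD'.le (Or.inl le_rfl)
  linarith

end Summit.CriticalPhenomena.PercolationContinuityZ3.Theorems.SahiAEFourFunctions.Plane
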